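import Literature.MathematicalPhysics.QuantumLattice.SpinSystemProofs
import HarnessLib

/-!
# Local operators: multiplicativity and transport along block bijections

Elementary bookkeeping for the concrete `ℓ²`-picture of finite quantum spin systems of
`Literature.MathematicalPhysics.QuantumLattice.SpinSystem` (`localOp X A = A ⊗ 𝟙_{Λ∖X}`,
`onSite x a`): **transport of block operators**. Given a labelling `g : ι → X` of the sites of a
region `X ⊆ Λ` which is a bijection, an operator `P : Op ι q` on the abstract block `ι` is placed
on `X` as `localOp X (P.submatrix (· ∘ g) (· ∘ g))` (this is how `parentHamiltonian` of
`MatrixProductStates` places its `ℓ`-site term on the blocks `{x, …, x+ℓ-1}` of the ring `ℤ/L`,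
`onRingBlock`). We prove that this placement is unital, additive, homogeneous, multiplicative
(`localOp_submatrix_one/add/smul/sum/mul`; multiplicativity of `localOp` itself is
`localOp_mul_holds` of `SpinSystemProofs`) and that it sends the single-site operator `onSite i a`
to `onSite (g i) a` (`localOp_submatrix_onSite`), so that e.g. spin operators and exchange
operators `𝐒_i · 𝐒_j` on the abstract block go to the corresponding operators at the sites
`g i, g j ∈ Λ`.

No new definitions are introduced (the configuration bijection `(X → Fin q) ≃ (ι → Fin q)` induced
by `g` is only asserted to exist, `exists_config_equiv`).

## Sources

O. Bratteli, D. W. Robinson, *Operator Algebras and Quantum Statistical Mechanics II* (2nd ed.,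
Springer 1997), §6.2.1 (local algebras `𝔄_X ≅ B(𝓗_X) ⊗ 𝟙`, isotony, the homomorphism property of
`A ↦ A ⊗ 𝟙`); B. Nachtergaele, R. Sims, Comm. Math. Phys. 265 (2006), §2.

## Mathlib / Literature status

Uses `Matrix.submatrix_one_equiv`, `Matrix.submatrix_mul_equiv` from Mathlib, `localOp_apply`,
`onSite_apply`, `localOp_one/add/smul` from `SpinSystem` and `localOp_mul_holds` from
`SpinSystemProofs`. Mathlib's `Matrix.reindexAlgEquiv` covers the reindexing half (cf.
`reindexOp`), but not the composite with `localOp`, which is what the parent-Hamiltonian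
statements use verbatim.
-/

noncomputable section

open Matrix Complex

namespace Literature.MathematicalPhysics.QuantumLattice

section QLattice

variable {Λ : Type*} [Fintype Λ] [DecidableEq Λ] {q : ℕ}

/-! ### Transport of block operators along a bijection `g : ι → X` -/

variable {ι : Type*}

omit [Fintype Λ] [DecidableEq Λ] in
/-- A bijective labelling `g : ι → X` of the sites of a region induces a bijection of block
configurations `(X → Fin q) ≃ (ι → Fin q)`, `σ ↦ σ ∘ g` (only its existence is recorded, so that no
auxiliary definition is needed). [folklore] -/
theorem exists_config_equiv (X : Finset Λ) {g : ι → X} (hg : Function.Bijective g) :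
    ∃ e : (X → Fin q) ≃ (ι → Fin q), ⇑e = fun σ j => σ (g j) :=
  ⟨{ toFun := fun σ j => σ (g j)
     invFun := fun κ y => κ ((Equiv.ofBijective g hg).symm y)
     left_inv := fun σ => funext fun y => by
       simp only [Equiv.ofBijective_apply_symm_apply]
     right_inv := fun κ => funext fun j => by
       simp only [Equiv.ofBijective_symm_apply_apply] }, rfl⟩

/-- Transport of block operators is additive. Bratteli–Robinson II §6.2.1. [folklore] -/
theorem localOp_submatrix_add (X : Finset Λ) (g : ι → X) (P Q : Op ι q) :
    localOp X ((P + Q).submatrix (fun σ j => σ (g j)) (fun σ j => σ (g j))) =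
      localOp X (P.submatrix (fun σ j => σ (g j)) (fun σ j => σ (g j))) +
        localOp X (Q.submatrix (fun σ j => σ (g j)) (fun σ j => σ (g j))) :=
  localOp_add X _ _

/-- Transport of block operators commutes with scalars. Bratteli–Robinson II §6.2.1. [folklore] -/
theorem localOp_submatrix_smul (X : Finset Λ) (g : ι → X) (c : ℂ) (P : Op ι q) :
    localOp X ((c • P).submatrix (fun σ j => σ (g j)) (fun σ j => σ (g j))) =
      c • localOp X (P.submatrix (fun σ j => σ (g j)) (fun σ j => σ (g j))) :=
  localOp_smul X c _

/-- Transport of block operators is compatible with finite sums. [folklore] -/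
theorem localOp_submatrix_sum (X : Finset Λ) (g : ι → X) {β : Type*} (s : Finset β)
    (P : β → Op ι q) :
    localOp X ((∑ b ∈ s, P b).submatrix (fun σ j => σ (g j)) (fun σ j => σ (g j))) =
      ∑ b ∈ s, localOp X ((P b).submatrix (fun σ j => σ (g j)) (fun σ j => σ (g j))) := by
  classical
  induction s using Finset.induction_on with
  | empty => simp
  | insert b s hb ih => rw [Finset.sum_insert hb, Finset.sum_insert hb, localOp_submatrix_add, ih]

/-- Transport of block operators along a *bijective* labelling is unital: `𝟙 ↦ 𝟙`.
Bratteli–Robinson II §6.2.1. [folklore] -/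
theorem localOp_submatrix_one [Fintype ι] (X : Finset Λ) {g : ι → X} (hg : Function.Bijective g) :
    localOp X ((1 : Op ι q).submatrix (fun σ j => σ (g j)) (fun σ j => σ (g j))) = 1 := by
  obtain ⟨e, he⟩ := exists_config_equiv (q := q) X hg
  rw [← he, submatrix_one_equiv, localOp_one]

/-- Transport of block operators along a *bijective* labelling is multiplicative (reindexing along a
bijection of configurations is, `Matrix.submatrix_mul_equiv`, and so is `localOp`,
`localOp_mul_holds`). Bratteli–Robinson II §6.2.1. [folklore] -/
theorem localOp_submatrix_mul [Fintype ι] [DecidableEq ι] (X : Finset Λ) {g : ι → X} (hg : Function.Bijective g)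
    (P Q : Op ι q) :
    localOp X ((P * Q).submatrix (fun σ j => σ (g j)) (fun σ j => σ (g j))) =
      localOp X (P.submatrix (fun σ j => σ (g j)) (fun σ j => σ (g j))) *
        localOp X (Q.submatrix (fun σ j => σ (g j)) (fun σ j => σ (g j))) := by
  obtain ⟨e, he⟩ := exists_config_equiv (q := q) X hg
  have hmul : ∀ A B : Matrix (X → Fin q) (X → Fin q) ℂ,
      localOp X (A * B) = localOp X A * localOp X B := localOp_mul_holds X
  rw [← he, ← submatrix_mul_equiv P Q _ e _, hmul]

/-- Transport of block operators along a *bijective* labelling `g` sends the single-site operator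
`a` at the abstract site `i` to the single-site operator `a` at the lattice site `g i`:
`(𝟙 ⊗ ⋯ ⊗ a ⊗ ⋯ ⊗ 𝟙)` relabelled and tensored with `𝟙_{Λ∖X}` is `a` at `g i`.
Tasaki (2020) §2.2, eq. (2.2.5); Bratteli–Robinson II §6.2.1. [folklore] -/
theorem localOp_submatrix_onSite [Fintype ι] [DecidableEq ι] (X : Finset Λ) {g : ι → X} (hg : Function.Bijective g) (i : ι)
    (a : Matrix (Fin q) (Fin q) ℂ) :
    localOp X ((onSite i a).submatrix (fun σ j => σ (g j)) (fun σ j => σ (g j))) =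
      onSite (g i : Λ) a := by
  ext σ τ
  simp only [localOp_apply, submatrix_apply, onSite_apply]
  by_cases h : ∀ y, y ≠ (g i : Λ) → σ y = τ y
  · have hout : ∀ y, y ∉ X → σ y = τ y :=
      fun y hy => h y fun hyi => hy (by rw [hyi]; exact (g i).2)
    have hin : ∀ j, j ≠ i → σ (g j) = τ (g j) :=
      fun j hj => h _ fun hji => hj (hg.1 (Subtype.ext hji))
    rw [if_pos h, if_pos hout, if_pos hin]
  · rw [if_neg h]
    split_ifs with h1 h2
    · refine absurd (fun y hy => ?_) h
      by_cases hyX : y ∈ X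
      · obtain ⟨j, hj⟩ := hg.2 ⟨y, hyX⟩
        have hji : j ≠ i := fun hji => hy (by rw [← hji, hj])
        have hy' := h2 j hji
        rwa [hj] at hy'
      · exact h1 y hyX
    · rfl
    · rfl

end QLattice

end Literature.MathematicalPhysics.QuantumLattice
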